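import Literature.AnabelianGeometry.EtaleTheta.Discharge.Sec2MonodromyModelDottedMembers
import Literature.AnabelianGeometry.EtaleTheta.Discharge.Sec2MonodromyModelAutLemmas
import Literature.AnabelianGeometry.EtaleTheta.Discharge.Sec2Prop26InstanceForms
import HarnessLib

/-!
# [EtTh] Prop. 2.6 (characteristic nature of the dotted coverings) HOLDS at the monodromy model:
# `(monodromyModel l hl).Prop26`, every odd `l` — the instance form of FACT-LIST F-0610 is INHABITED (proof-only)

S. Mochizuki, *The étale theta function and its Frobenioid-theoretic manifestations* [EtTh], Publ. RIMS **45**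
(2009), §2 Prop. 2.6 (PDF p. 40): «any isomorphism `Π^tp_{Ẋ̲̲_α} ⥲ Π^tp_{Ẋ̲̲_β}` (resp. `Ẋ̲`; `Ċ̲̲`; `Ċ̲`) induces isomorphisms
compatible with the various natural maps between the respective `Π^tp`'s of `X̲̲` (resp. `X̲`; `C̲̲`; `C̲`) and `Ċ`»;
Rmk. 2.6.1 [cite: MochizukiEtTh2009, Prop 2.6 p.40] [cite: MochizukiEtTh2009, Rmk 2.6.1 p.40].  Cell abc-iut, layer L2,
seat abc-iut-w6-d084 (gen 7), «P26-NV MONODROMY TOY» STAGE 2 (abc-iut-L2-lead R1352 GO; K4 rows 24/36 of abc-iut-c312-2).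
PROOF-ONLY (no definition, no named fact).

WHAT IS PROVED.  For the typed one-object form `TemperedCoverData.Prop26` of abc-iut-L2-t2 (FACT-LIST F-0610, class
«universal-closure REFUTED / schema»: `TemperedModel.not_forall_prop26`, abc-iut-f-143 p435476; instance form REFUTED at
every previously decided datum — the toy of record and the κ′ cover, p475371/p484548/p489452) there IS a datum where it
HOLDS: **`prop26_monodromyModel : (monodromyModel l hl).Prop26`** for EVERY odd `l`, together with `HasMuL` («`K ⊇ μ_l`»);
hence `exists_temperedCoverData_prop26` and the census pair `prop26_instance_inhabited_and_closure_refuted` (the schema is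
neither a theorem nor vacuous over the typed interface).  MECHANISM (Rmk. 2.6.1's shapes): the dotted members of the model
are `Π^tp_{Ẋ̲̲} ≅ ℤ`, `Π^tp_{Ẋ̲} ≅ ℤ/l × ℤ`, `Π^tp_{Ċ̲̲} ≅ D_∞`, `Π^tp_{Ċ̲} ≅ ℤ/l × D_∞`
(`Sec2MonodromyModelDottedMembers`); every automorphism of these groups is censused (`Sec2MonodromyModelAutLemmas`) and is the
restriction of a composite of `conj(ι)`, `conj(x^a)`, `halfShift k` («conjugation by `t^{k/2}`»), `scaleAut u`
(`ThetaCoversMonodromyModelAut`), each of which stabilises the undotted member and `Π^tp_Ċ`; abc-iut-w6-d082's pointwise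
reduction `extendsStabilising_dotted_of_extension` (p489891) concludes.

HONEST LABEL (R1352): a DESIGNED tempered toy with print's monodromy combinatorics — loop ↦ `Δ̄^ell` (`b`-cycle), the
inversion INVERTS it, unipotent monodromy `x ↦ x·z` on the `a`-cycle, `z` = cusp inertia = `Δ̄_Θ` central; `G_K := 1`;
NOT a Tate curve, NOT the tempered fundamental group of a curve.  It witnesses CONSISTENCY of the typed interface together
with the typed Prop. 2.6 (non-vacuity of the cone's FACT binder `h : T.Prop26`), nothing about print's Prop. 2.6, whose
content is absolute anabelian geometry; typed ≠ proved; no side is taken on [IUTchIII] Cor. 3.12 or on any author.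
-/

noncomputable section

namespace Literature.AnabelianGeometry.EtaleTheta.ThetaCovers.MonodromyModel

open Multiplicative HeisenbergWitness TemperedModel DihedralGroup
open KummerWitness (map_equiv_eq_of_iff)

variable (l : ℕ)

/-! ## 1. The sign automorphism `conj(ι)^{[m = −1]}` -/

/-- For `m = ±1` there is an automorphism `C` of `TG l` (identity or `conj(ι)`) acting on `embCu (c, d)` by `d ↦ ψ_m(d)`
(`r^i ↦ r^{m i}`, `s r^i ↦ s r^{m i}`) and stabilising the members. (toy bookkeeping for [EtTh] Prop. 2.6; no claim about
print) [cite: MochizukiEtTh2009, Prop 2.6 p.40] -/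
theorem exists_signAut (m : ZMod 0) (hm : m = 1 ∨ m = -1) :
    ∃ C : TG l ≃* TG l,
      (∀ (c : Multiplicative (ZMod l)) (i : ZMod 0), C (embCu l (c, r i)) = embCu l (c, r (m * i))) ∧
      (∀ (c : Multiplicative (ZMod l)) (i : ZMod 0), C (embCu l (c, sr i)) = embCu l (c, sr (m * i))) ∧
      ((heisB0 l).comap (PhiT l)).map C.toMonoidHom = (heisB0 l).comap (PhiT l) ∧
      ((heisD l).comap (PhiT l)).map C.toMonoidHom = (heisD l).comap (PhiT l) ∧
      ((heisPiX l).comap (PhiT l)).map C.toMonoidHom = (heisPiX l).comap (PhiT l) ∧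
      (PiCdotT l).map C.toMonoidHom = PiCdotT l := by
  rcases hm with rfl | rfl
  · refine ⟨MulEquiv.refl _, fun c i => by rw [one_mul]; rfl, fun c i => by rw [one_mul]; rfl, ?_, ?_, ?_, ?_⟩ <;>
      exact map_equiv_eq_of_iff _ _ fun g => Iff.rfl
  · refine ⟨MulAut.conj (iotaT l), fun c i => ?_, fun c i => ?_, (conj_iotaT_stabilises l).1,
      (conj_iotaT_stabilises l).2.1, (conj_iotaT_stabilises l).2.2.1, (conj_iotaT_stabilises l).2.2.2⟩
    · rw [conj_iotaT_embCu, (sr_conj_dihedral i).1, neg_one_mul]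
    · rw [conj_iotaT_embCu, (sr_conj_dihedral i).2, neg_one_mul]

/-- `(r 1)^k = r^k` in `D_∞` for an integer `k` (Mathlib's `r_one_zpow` without the cast `ℤ → ZMod 0 = ℤ`).
(toy bookkeeping; no claim about print) [cite: MochizukiEtTh2009, Prop 2.6 p.40] -/
theorem r_one_zpow_int (k : ℤ) : (r 1 : DihedralGroup 0) ^ k = r k := r_one_zpow k

/-! ## 2. The four extension lemmas -/

section Extensions

/-- **`Π^tp_{Ċ̲}`**: every automorphism of `Π^tp_{Ċ̲} ≅ ℤ/l × D_∞` extends to `TG l` stabilising `Π^tp_{C̲}` and `Π^tp_Ċ`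
(`Γ = scaleAut u ∘ halfShift k ∘ conj(ι)^{[m=−1]}`). (the typed [EtTh] Prop. 2.6, case `Ċ̲`, AT THE MODEL; no claim about
print) [cite: MochizukiEtTh2009, Prop 2.6 p.40] -/
theorem exists_extension_dotCu (hl : Odd l) {Z : Subgroup (TG l)} (hZ : Z = (heisB0 l).comap (PhiT l))
    (γ : ↥(Z ⊓ PiCdotT l) ≃* ↥(Z ⊓ PiCdotT l)) :
    ∃ Γ : TG l ≃* TG l, (∀ h : ↥(Z ⊓ PiCdotT l), (Γ h : TG l) = γ h) ∧
      Z.map Γ.toMonoidHom = Z ∧ (PiCdotT l).map Γ.toMonoidHom = PiCdotT l := by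
  subst hZ
  let e : (Multiplicative (ZMod l) × DihedralGroup 0) ≃* ↥((heisB0 l).comap (PhiT l) ⊓ PiCdotT l) :=
    (MonoidHom.ofInjective (embCu_injective l)).trans (MulEquiv.subgroupCongr (range_embCu l))
  have he : ∀ p, ((e p : ↥((heisB0 l).comap (PhiT l) ⊓ PiCdotT l)) : TG l) = embCu l p := fun p => rfl
  obtain ⟨_, m, k, ⟨u', rfl⟩, hm, hr, hs⟩ := mulEquiv_zmodProdDihedral_census l hl (e.trans (γ.trans e.symm))
  obtain ⟨C, hCr, hCs, hCB0, -, -, hCdot⟩ := exists_signAut l m hm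
  refine ⟨(C.trans (halfShift l hl k)).trans (scaleAut l u'), fun h => ?_, ?_, ?_⟩
  · -- restriction: compare on `embCu p`, `p := e⁻¹ h`
    have hγ : (γ h : TG l) = embCu l ((e.trans (γ.trans e.symm)) (e.symm h)) := by
      rw [← he]; simp only [MulEquiv.trans_apply, MulEquiv.apply_symm_apply]
    rw [hγ, show (h : TG l) = embCu l (e.symm h) by rw [← he, MulEquiv.apply_symm_apply]]
    rcases e.symm h with ⟨c, j | j⟩
    · rw [hr, MulEquiv.trans_apply, MulEquiv.trans_apply, hCr, halfShift_embCu, dihedralShift_r, scaleAut_embCu]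
    · rw [hs, MulEquiv.trans_apply, MulEquiv.trans_apply, hCs, halfShift_embCu, dihedralShift_sr, scaleAut_embCu]
  · exact map_trans_eq _ _ _ (map_trans_eq _ _ _ hCB0 (halfShift_stabilises l hl k).1) (scaleAut_stabilises l u').1
  · exact map_trans_eq _ _ _ (map_trans_eq _ _ _ hCdot (halfShift_stabilises l hl k).2.2.2)
      (scaleAut_stabilises l u').2.2.2

/-- **`Π^tp_{Ċ̲̲}`**: every automorphism of `Π^tp_{Ċ̲̲} ≅ D_∞` extends to `TG l` stabilising `Π^tp_{C̲̲}` and `Π^tp_Ċ`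
(`Γ = halfShift k ∘ conj(ι)^{[m=−1]}`). (the typed [EtTh] Prop. 2.6, case `Ċ̲̲`, AT THE MODEL; no claim about print)
[cite: MochizukiEtTh2009, Prop 2.6 p.40] -/
theorem exists_extension_dotCuu (hl : Odd l) {Z : Subgroup (TG l)} (hZ : Z = (heisD l).comap (PhiT l))
    (γ : ↥(Z ⊓ PiCdotT l) ≃* ↥(Z ⊓ PiCdotT l)) :
    ∃ Γ : TG l ≃* TG l, (∀ h : ↥(Z ⊓ PiCdotT l), (Γ h : TG l) = γ h) ∧
      Z.map Γ.toMonoidHom = Z ∧ (PiCdotT l).map Γ.toMonoidHom = PiCdotT l := by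
  subst hZ
  let ψ : DihedralGroup 0 →* TG l := (embCu l).comp (MonoidHom.inr (Multiplicative (ZMod l)) (DihedralGroup 0))
  have hψ : Function.Injective ψ := (embCu_injective l).comp fun a b h => (Prod.ext_iff.mp h).2
  let e : DihedralGroup 0 ≃* ↥((heisD l).comap (PhiT l) ⊓ PiCdotT l) :=
    (MonoidHom.ofInjective hψ).trans (MulEquiv.subgroupCongr (range_embCu_inr l))
  have he : ∀ d, ((e d : ↥((heisD l).comap (PhiT l) ⊓ PiCdotT l)) : TG l) = embCu l (1, d) := fun d => rfl
  obtain ⟨m, k, hm, hr, hs⟩ := mulEquiv_dihedralZero_census (e.trans (γ.trans e.symm))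
  obtain ⟨C, hCr, hCs, -, hCD, -, hCdot⟩ := exists_signAut l m hm
  refine ⟨C.trans (halfShift l hl k), fun h => ?_, ?_, ?_⟩
  · have hγ : (γ h : TG l) = embCu l (1, (e.trans (γ.trans e.symm)) (e.symm h)) := by
      rw [← he]; simp only [MulEquiv.trans_apply, MulEquiv.apply_symm_apply]
    rw [hγ, show (h : TG l) = embCu l (1, e.symm h) by rw [← he, MulEquiv.apply_symm_apply]]
    rcases e.symm h with j | j
    · rw [hr, MulEquiv.trans_apply, hCr, halfShift_embCu, dihedralShift_r]
    · rw [hs, MulEquiv.trans_apply, hCs, halfShift_embCu, dihedralShift_sr]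
  · exact map_trans_eq _ _ _ hCD (halfShift_stabilises l hl k).2.1
  · exact map_trans_eq _ _ _ hCdot (halfShift_stabilises l hl k).2.2.2

/-- **`Π^tp_{Ẋ̲̲}`**: every automorphism of `Π^tp_{Ẋ̲̲} ≅ ℤ` (i.e. `±1`) extends to `TG l` stabilising `Π^tp_{X̲̲}` and `Π^tp_Ċ`
(`Γ = conj(ι)^{[m=−1]}`). (the typed [EtTh] Prop. 2.6, case `Ẋ̲̲`, AT THE MODEL; no claim about print)
[cite: MochizukiEtTh2009, Prop 2.6 p.40] -/
theorem exists_extension_dotXuu (hl : Odd l) {Z : Subgroup (TG l)} (hZ : Z = (heisD l ⊓ heisPiX l).comap (PhiT l))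
    (γ : ↥(Z ⊓ PiCdotT l) ≃* ↥(Z ⊓ PiCdotT l)) :
    ∃ Γ : TG l ≃* TG l, (∀ h : ↥(Z ⊓ PiCdotT l), (Γ h : TG l) = γ h) ∧
      Z.map Γ.toMonoidHom = Z ∧ (PiCdotT l).map Γ.toMonoidHom = PiCdotT l := by
  have _ := hl
  subst hZ
  let ψ : Multiplicative ℤ →* TG l := (embCu l).comp ((MonoidHom.inr (Multiplicative (ZMod l)) (DihedralGroup 0)).comp
    (zpowersHom (DihedralGroup 0) (r 1)))
  have hψapply : ∀ n, ψ n = embCu l (1, r (toAdd n : ℤ)) := fun n => by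
    simp only [ψ, MonoidHom.comp_apply, zpowersHom_apply, MonoidHom.inr_apply, r_one_zpow_int]
    all_goals rfl
  have hψ : Function.Injective ψ := fun a b h => by
    rw [hψapply, hψapply] at h
    have h2 := congrArg Prod.snd (embCu_injective l h)
    have h3 : toAdd a = toAdd b := by injection h2
    exact toAdd.injective h3
  let e : Multiplicative ℤ ≃* ↥((heisD l ⊓ heisPiX l).comap (PhiT l) ⊓ PiCdotT l) :=
    (MonoidHom.ofInjective hψ).trans (MulEquiv.subgroupCongr (range_embCu_inr_zpowers l))
  have he : ∀ n, ((e n : ↥((heisD l ⊓ heisPiX l).comap (PhiT l) ⊓ PiCdotT l)) : TG l) = embCu l (1, r (toAdd n : ℤ)) :=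
    fun n => hψapply n
  obtain ⟨m, hm, hφ⟩ := mulEquiv_int_census (e.trans (γ.trans e.symm))
  obtain ⟨C, hCr, -, -, hCD, hCX, hCdot⟩ := exists_signAut l m hm
  refine ⟨C, fun h => ?_, ?_, hCdot⟩
  · have hγ : (γ h : TG l) = embCu l (1, r (toAdd ((e.trans (γ.trans e.symm)) (e.symm h)) : ℤ)) := by
      rw [← he]; simp only [MulEquiv.trans_apply, MulEquiv.apply_symm_apply]
    rw [hγ, show (h : TG l) = embCu l (1, r (toAdd (e.symm h) : ℤ)) by rw [← he, MulEquiv.apply_symm_apply], hCr, hφ,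
      toAdd_ofAdd]
    rfl
  · rw [Subgroup.comap_inf, Subgroup.map_inf_eq _ _ C.toMonoidHom C.injective, hCD, hCX]

/-- **`Π^tp_{Ẋ̲}`**: every automorphism of `Π^tp_{Ẋ̲} ≅ ℤ/l × ℤ` extends to `TG l` stabilising `Π^tp_{X̲}` and `Π^tp_Ċ`
(`Γ = scaleAut u ∘ conj(x^a) ∘ conj(ι)^{[m=−1]}` with `a = −k u⁻¹ m`: the twist `t ↦ z^k t` is INNER in the monodromy model).
(the typed [EtTh] Prop. 2.6, case `Ẋ̲`, AT THE MODEL; no claim about print) [cite: MochizukiEtTh2009, Prop 2.6 p.40] -/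
theorem exists_extension_dotXu [NeZero l] (hl : Odd l) {Z : Subgroup (TG l)} (hZ : Z = (heisB0 l ⊓ heisPiX l).comap (PhiT l))
    (γ : ↥(Z ⊓ PiCdotT l) ≃* ↥(Z ⊓ PiCdotT l)) :
    ∃ Γ : TG l ≃* TG l, (∀ h : ↥(Z ⊓ PiCdotT l), (Γ h : TG l) = γ h) ∧
      Z.map Γ.toMonoidHom = Z ∧ (PiCdotT l).map Γ.toMonoidHom = PiCdotT l := by
  have _ := hl
  subst hZ
  -- the parametrisation `ψ : ℤ/l × ℤ → Π^tp_{Ẋ̲}`, `(c, n) ↦ ((0, c), r^n, 1)`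
  let ψ : Multiplicative (ZMod l × ℤ) →* TG l :=
    MonoidHom.mk' (fun x => embCu l (ofAdd (toAdd x).1, r ((toAdd x).2 : ℤ))) fun x y => by
      rw [← map_mul, Prod.mk_mul_mk, ← ofAdd_add, r_mul_r, toAdd_mul, Prod.fst_add]
      rfl
  have hψapply : ∀ x, ψ x = embCu l (ofAdd (toAdd x).1, r ((toAdd x).2 : ℤ)) := fun x => rfl
  have hψ : Function.Injective ψ := fun a b h => by
    rw [hψapply, hψapply] at h
    have h2 := embCu_injective l h
    rw [Prod.mk.injEq] at h2
    have h3 : (toAdd a).2 = (toAdd b).2 := by injection h2.2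
    exact toAdd.injective (Prod.ext (ofAdd.injective h2.1) h3)
  have hrange : ψ.range = (heisB0 l ⊓ heisPiX l).comap (PhiT l) ⊓ PiCdotT l := by
    ext g
    rw [MonoidHom.mem_range, mem_dotXu_iff]
    constructor
    · rintro ⟨x, rfl⟩; exact ⟨_, _, hψapply x⟩
    · rintro ⟨c, j, rfl⟩
      exact ⟨ofAdd (c, j), by rw [hψapply, toAdd_ofAdd]⟩
  let e : Multiplicative (ZMod l × ℤ) ≃* ↥((heisB0 l ⊓ heisPiX l).comap (PhiT l) ⊓ PiCdotT l) :=
    (MonoidHom.ofInjective hψ).trans (MulEquiv.subgroupCongr hrange)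
  have he : ∀ x, ((e x : ↥((heisB0 l ⊓ heisPiX l).comap (PhiT l) ⊓ PiCdotT l)) : TG l) =
      embCu l (ofAdd (toAdd x).1, r ((toAdd x).2 : ℤ)) := fun x => hψapply x
  obtain ⟨_, k, m, ⟨u', rfl⟩, hm, hφ⟩ := mulEquiv_zmodProdInt_census l (e.trans (γ.trans e.symm))
  obtain ⟨C, hCr, -, hCB0, -, hCX, hCdot⟩ := exists_signAut l m hm
  -- the twist parameter `a = -k u⁻¹ m`
  have hm2 : (m : ZMod l) * (m : ZMod l) = 1 := by
    rcases hm with rfl | rfl <;> simp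
  have huinv : ((u' : ZMod l)) * ↑u'⁻¹ = 1 := Units.mul_inv u'
  have key : ∀ (x1 : ZMod l) (i : ZMod 0),
      (u' : ZMod l) * (x1 - ZMod.castHom (dvd_zero l) (ZMod l) (HMul.hMul (α := ZMod 0) (β := ZMod 0) m i) *
        -(k * ↑u'⁻¹ * (m : ZMod l))) = ↑u' * x1 + k * @Int.cast (ZMod l) _ i := fun x1 i => by
    have hc1 : ZMod.castHom (dvd_zero l) (ZMod l) (m : ZMod 0) = (m : ZMod l) := rfl
    have hc2 : ZMod.castHom (dvd_zero l) (ZMod l) i = @Int.cast (ZMod l) _ i := rfl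
    rw [map_mul, hc1, hc2]
    linear_combination (k * (@Int.cast (ZMod l) _ i) * (m : ZMod l) ^ 2) * huinv + (k * (@Int.cast (ZMod l) _ i)) * hm2
  refine ⟨(C.trans (MulAut.conj (xElt l (-(k * ↑u'⁻¹ * (m : ZMod l)))))).trans (scaleAut l u'), fun h => ?_, ?_, ?_⟩
  · have hγ : (γ h : TG l) = embCu l (ofAdd (toAdd ((e.trans (γ.trans e.symm)) (e.symm h))).1,
        r ((toAdd ((e.trans (γ.trans e.symm)) (e.symm h))).2 : ℤ)) := by
      rw [← he]; simp only [MulEquiv.trans_apply, MulEquiv.apply_symm_apply]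
    rw [hγ, show (h : TG l) = embCu l (ofAdd (toAdd (e.symm h)).1, r ((toAdd (e.symm h)).2 : ℤ)) by
      rw [← he, MulEquiv.apply_symm_apply]]
    generalize e.symm h = x
    have hφx : (e.trans (γ.trans e.symm)) x = ofAdd (↑u' * (toAdd x).1 + k * ((toAdd x).2 : ZMod l), m * (toAdd x).2) := by
      have h1 := hφ (toAdd x).1 (toAdd x).2
      rwa [Prod.mk.eta, ofAdd_toAdd] at h1
    rw [hφx, toAdd_ofAdd]
    dsimp only
    rw [MulEquiv.trans_apply, MulEquiv.trans_apply, hCr, MulAut.conj_apply, conj_xElt_embCu_r, scaleAut_embCu,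
      toAdd_ofAdd, key]
    rfl
  · rw [Subgroup.comap_inf]
    refine map_trans_eq _ _ _ (map_trans_eq _ _ _ ?_ ?_) ?_
    · rw [Subgroup.map_inf_eq _ _ C.toMonoidHom C.injective, hCB0, hCX]
    · rw [← Subgroup.comap_inf]; exact (conj_xElt_stabilises l _).1
    · rw [Subgroup.map_inf_eq _ _ (scaleAut l u').toMonoidHom (scaleAut l u').injective, (scaleAut_stabilises l u').1,
        (scaleAut_stabilises l u').2.2.1]
  · exact map_trans_eq _ _ _ (map_trans_eq _ _ _ hCdot (conj_xElt_stabilises l _).2) (scaleAut_stabilises l u').2.2.2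

end Extensions

/-! ## 3. Prop. 2.6 and `K ⊇ μ_l` at the monodromy model; the census pair for F-0610 -/

section Model

variable [NeZero l]

omit [NeZero l] in
/-- A bare automorphism of the discrete `Π^tp_C = TG l` is a topological one. (toy bookkeeping; no claim about print)
[cite: MochizukiEtTh2009, Prop 2.6 p.40] -/
theorem exists_continuousMulEquiv_of_mulEquiv (Γ : TG l ≃* TG l) :
    ∃ Γ' : TG l ≃ₜ* TG l, ∀ g, Γ' g = Γ g :=
  ⟨{ Γ with continuous_toFun := continuous_of_discreteTopology, continuous_invFun := continuous_of_discreteTopology },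
    fun _ => rfl⟩

/-- **[EtTh] Prop. 2.6 AS TYPED (`TemperedCoverData.Prop26`, FACT-LIST F-0610) HOLDS at the monodromy model**, for every
odd `l`: every topological automorphism of `Π^tp_{Ẋ̲̲}`, `Π^tp_{Ẋ̲}`, `Π^tp_{Ċ̲̲}`, `Π^tp_{Ċ̲}` extends to `Π^tp_C`
stabilising the dotted member, the undotted member and `Π^tp_Ċ`.  First INHABITED instance of the F-0610 instance form in
the tree (it FAILS at the toy of record and at the κ′ cover).  CONSISTENCY of the typed interface + typed Prop. 2.6 only;
nothing about print's Prop. 2.6. [cite: MochizukiEtTh2009, Prop 2.6 p.40] -/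
theorem prop26_monodromyModel (hl : Odd l) : (monodromyModel l hl).Prop26 := by
  intro Z hZ γ
  simp only [List.mem_cons, List.mem_nil_iff, or_false] at hZ
  have main : ∀ {Z : Subgroup (TG l)},
      (∀ γ' : ↥(Z ⊓ PiCdotT l) ≃* ↥(Z ⊓ PiCdotT l), ∃ Γ : TG l ≃* TG l,
        (∀ h : ↥(Z ⊓ PiCdotT l), (Γ h : TG l) = γ' h) ∧ Z.map Γ.toMonoidHom = Z ∧
          (PiCdotT l).map Γ.toMonoidHom = PiCdotT l) →
      ∀ γ : ↥(Z ⊓ (monodromyModel l hl).PiCdot) ≃ₜ* ↥(Z ⊓ (monodromyModel l hl).PiCdot),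
        (monodromyModel l hl).ExtendsStabilising _ γ [Z ⊓ (monodromyModel l hl).PiCdot, Z, (monodromyModel l hl).PiCdot] := by
    intro Z hex γ
    obtain ⟨Γ, hΓ, hZst, hCst⟩ := hex γ.toMulEquiv
    obtain ⟨Γ', hΓ'⟩ := exists_continuousMulEquiv_of_mulEquiv l Γ
    refine (monodromyModel l hl).extendsStabilising_dotted_of_extension γ Γ' (fun h => ?_) ?_ ?_
    · rw [hΓ']; exact hΓ h
    · rw [show Γ'.toMulEquiv.toMonoidHom = Γ.toMonoidHom from MonoidHom.ext hΓ']; exact hZst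
    · rw [show Γ'.toMulEquiv.toMonoidHom = Γ.toMonoidHom from MonoidHom.ext hΓ']; exact hCst
  rcases hZ with rfl | rfl | rfl | rfl
  · exact main (fun γ' => exists_extension_dotXuu l hl (tp_PiXuu l hl) γ') γ
  · exact main (fun γ' => exists_extension_dotXu l hl (tp_PiXu l hl) γ') γ
  · exact main (fun γ' => exists_extension_dotCuu l hl (tp_PiCuu l hl) γ') γ
  · exact main (fun γ' => exists_extension_dotCu l hl (tp_PiCu l hl) γ') γ

omit [NeZero l] in
/-- `Δ̄_Θ = {(0, c)}` is central in the Heisenberg witness. (toy bookkeeping for [EtTh] Rmk. 2.6.1 «`K ⊇ μ_l`»; no claim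
about print) [cite: MochizukiEtTh2009, Rmk 2.6.1 p.40] -/
theorem heisTheta_comm (x t : heisPiC l) (ht : t ∈ heisTheta l) : x * t * x⁻¹ * t⁻¹ = 1 := by
  obtain ⟨ht1, ht2⟩ := (mem_heisTheta l).mp ht
  rcases hx : x.right with i | i
  · refine eq_one_of_coords l ?_ ?_ ?_
    · simp [ht1, hx]
    · simp [ht1, ht2, hx]
    · simp [ht1, ht2, hx]
  · refine eq_one_of_coords l ?_ ?_ ?_
    · simp [ht1, hx]
    · simp [ht1, ht2, hx]
    · simp [ht1, ht2, hx]

/-- **`K ⊇ μ_l` (`HasMuL`) at the monodromy model**: `Π_C` acts trivially on `Δ̄_Θ` (the centre of the Heisenberg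
shadow). (toy bookkeeping for [EtTh] Rmk. 2.6.1; no claim about print) [cite: MochizukiEtTh2009, Rmk 2.6.1 p.40] -/
theorem hasMuL_monodromyModel (hl : Odd l) : (monodromyModel l hl).HasMuL := by
  intro c t ht
  change Phi l (c * t * c⁻¹ * t⁻¹) ∈ (⊥ : Subgroup (heisPiC l))
  rw [map_mul, map_mul, map_mul, map_inv, map_inv, Subgroup.mem_bot]
  exact heisTheta_comm l _ _ ht

/-- **The instance form of F-0610 is INHABITED**: there is a `TemperedCoverData l` (`l` odd) at which the typed Prop. 2.6
holds, with `K ⊇ μ_l`. (consistency witness for the typed interface; no claim about print) [cite: MochizukiEtTh2009, Prop 2.6 p.40] -/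
theorem exists_temperedCoverData_prop26 (hl : Odd l) : ∃ T : TemperedCoverData.{0} l, T.Prop26 ∧ T.HasMuL :=
  ⟨monodromyModel l hl, prop26_monodromyModel l hl, hasMuL_monodromyModel l hl⟩

/-- **Census pair for F-0610 / node EtTh:Prop2.6**: the instance form of the typed Prop. 2.6 is INHABITED (monodromy model,
this file) while its universal closure is REFUTED (abc-iut-f-143's `TemperedModel.not_forall_prop26`, the toy of record),
for every odd `l ≠ 1`: the schema is neither a theorem nor vacuous over the typed interface. (no claim about print;
refuted-as-typed ≠ refuted-in-print) [cite: MochizukiEtTh2009, Prop 2.6 p.40] -/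
theorem prop26_instance_inhabited_and_closure_refuted (hl : Odd l) (hl1 : l ≠ 1) :
    (∃ T : TemperedCoverData.{0} l, T.Prop26 ∧ T.HasMuL) ∧ ¬ ∀ T : TemperedCoverData.{0} l, T.Prop26 :=
  ⟨exists_temperedCoverData_prop26 l hl, TemperedModel.not_forall_prop26 l hl hl1⟩

end Model

end Literature.AnabelianGeometry.EtaleTheta.ThetaCovers.MonodromyModel

end
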